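import Mathlib
import HarnessLib.Audit
import Summits.PneNP.PneNP.Theorems.PstarCross2
import Summits.PneNP.PneNP.Theorems.PstarLocalUnionFive
import Summits.PneNP.PneNP.Theorems.PstarMultiUnionSplit

/-!
# Pinned partners linearise into the LOCAL union lemma: `TerminalFivePinned` holds (ROUND-25, memo §14.31; planner p3 g23's prover item of `r25/SketchCross2.lean`)

FRONTIER range-avoidance ladder, rung F-N3, ROUND 25 (cell `pnp-ideate`, planner memo `r24/CORE-BOUND-NOTES.md` §14.31; restricted-model proof complexity — nothing here
bears on `P` versus `NP`).

For a terminal pair `(w₁, w₂)` on the core `J₀` and a set `M` of monomials of `w₁`, each with a slot `sl g` whose variable is PINNED on `Z = Sol_y(J₀) ∩ {w₂ = t₂}` to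
`c g` (`PstarCross2.PinnedTo`), the constraint `A₀ := pinA₀ w₁ M sl c` (`w₁` with every `g ∈ M` replaced by `c g · x_{partner}`) agrees with `w₁` on `Z`, and at the
Terminal witness `x` of an output `f` the reader `A₁ := A₀ + Σ_{g ∈ M, x_{partner g} = 1} x_{I.vars g (sl g)}` (target `t₁ + Σ c g` over the same `g`) releases `f`:

* `sum_filter_odd` — a parity-indexed set of variables sums like the family it counts (`Σ_{v : odd multiplicity} f v = Σ_g f (φ g)` in `𝔽₂`);
* `bit_gval_pinA₀` — the evaluation identity `A₀(x) = w₁(x) + Σ_{g ∈ M} (x_{sl g} + c g) · x_{pt g}`;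
* `localUnionTerminal_of_pinnedPartners` — **p3's linearisation item, PROVED**: `Terminal ⟹ LocalUnionTerminal (pinA₀ w₁ M sl c, w₂)`;
* `terminalFivePinned_of_localUnionFive` (p3's glue, verbatim) and **`terminalFivePinned_holds : TerminalFivePinned`** — the PINNED-PARTNER class of O2 is a
  theorem: `w₂` hun-clean and every privates-touching monomial of `w₁` having a variable pinned on `Z` ⟹ `#J₀ ≤ 5` (`PstarLocalUnionFive.localUnionFive_holds`).
-/

set_option linter.dupNamespace false -- `Summit.PneNP.PneNP.…`: summit = sub-problem name (D-0017 single-conjunct layout)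

open Finset Literature.Computability.Complexity
open scoped symmDiff
open Summit.PneNP.PneNP.Theorems.PstarFibrePolys (bit bit_injective bit_xor)
open Summit.PneNP.PneNP.Theorems.PstarTyped (Typed)
open Summit.PneNP.PneNP.Theorems.PstarSALevel (varSet bdry BoundaryExpanding SimpleOverlap)
open Summit.PneNP.PneNP.Theorems.PstarGapOneAll (gval)
open Summit.PneNP.PneNP.Theorems.PstarGConstraint (bit_gval)
open Summit.PneNP.PneNP.Theorems.PstarGraphQuadGapTwoForms (sum_symmDiff_zmod2)
open Summit.PneNP.PneNP.Theorems.PstarCoreBound (XorClosed)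
open Summit.PneNP.PneNP.Theorems.PstarChordRepair (IsChord)
open Summit.PneNP.PneNP.Theorems.PstarChordBridgeCotree (Peelable)
open Summit.PneNP.PneNP.Theorems.PstarChordBridgeTools (privs)
open Summit.PneNP.PneNP.Theorems.PstarCoreBoundTargets (Terminal TerminalFiveA)
open Summit.PneNP.PneNP.Theorems.PstarUnion (SatPair)
open Summit.PneNP.PneNP.Theorems.PstarMultiUnion (LocalUnionTerminal LocalUnionFive)
open Summit.PneNP.PneNP.Theorems.PstarLocalUnionFive (localUnionFive_holds)
open Summit.PneNP.PneNP.Theorems.PstarMultiUnionSplit (tbit bit_tbit)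
open Summit.PneNP.PneNP.Theorems.PstarCross2 (PinnedTo eq_of_pinnedTo pt pinLin pinA₀ TerminalFivePinned)

namespace Summit.PneNP.PneNP.Theorems.PstarPinnedPartners

variable {n m : ℕ}

/-! ## Parity-indexed variable sets -/

/-- **A parity-indexed set of variables sums like the family it counts** (in `𝔽₂`): summing `f` over the variables `v` that are `φ g` for an odd number of
`g ∈ T` with `P g` is summing `f (φ g)` over those `g`. -/
theorem sum_filter_odd (T : Finset (Fin m)) (P : Fin m → Prop) [DecidablePred P] (φ : Fin m → Fin n) (f : Fin n → ZMod 2) :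
    ∑ v ∈ univ.filter (fun v => Odd (T.filter fun g => P g ∧ φ g = v).card), f v = ∑ g ∈ T.filter P, f (φ g) := by
  classical
  rw [sum_filter, ← sum_fiberwise_of_maps_to (s := T.filter P) (t := (univ : Finset (Fin n))) (g := φ) (fun g _ => mem_univ (φ g)) (fun g => f (φ g))]
  refine sum_congr rfl fun v _ => ?_
  rw [filter_filter]
  have e : ∑ g ∈ T.filter (fun g => P g ∧ φ g = v), f (φ g) = ∑ g ∈ T.filter (fun g => P g ∧ φ g = v), f v :=
    sum_congr rfl fun g hg => by rw [(mem_filter.1 hg).2.2]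
  rw [e, sum_const, nsmul_eq_mul]
  by_cases ho : Odd (T.filter fun g => P g ∧ φ g = v).card
  · rw [if_pos ho, ZMod.natCast_eq_one_iff_odd.2 ho, one_mul]
  · rw [if_neg ho, ZMod.natCast_eq_zero_iff_even.2 (Nat.not_odd_iff_even.1 ho), zero_mul]

/-! ## The evaluation identity of `pinA₀` -/

section Pin

variable (I : LocalMap 4 n m) (w₁ : Finset (Fin n) × Finset (Fin m) × Bool) {M : Finset (Fin m)} (hM : M ⊆ w₁.2.1) {sl : Fin m → Fin 4}
  (hsl : ∀ g ∈ M, sl g = 2 ∨ sl g = 3) (c : Fin m → Bool)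

include hsl in
/-- The monomial of `g ∈ M` as `x_{sl g} · x_{pt g}`. -/
theorem bit_mono_eq {g : Fin m} (hg : g ∈ M) (x : Fin n → Bool) :
    bit (x (I.vars g 2)) * bit (x (I.vars g 3)) = bit (x (I.vars g (sl g))) * bit (x (I.vars g (pt sl g))) := by
  rcases hsl g hg with h | h
  · have hp : pt sl g = 3 := by unfold pt; rw [if_pos h]
    rw [h, hp]
  · have hp : pt sl g = 2 := by unfold pt; rw [h, if_neg (by decide)]
    rw [h, hp, mul_comm]

/-- The linear correction sums the partners of the monomials pinned to `true`. -/
theorem sum_pinLin (x : Fin n → Bool) : ∑ v ∈ pinLin I M sl c, bit (x v) = ∑ g ∈ M, bit (c g) * bit (x (I.vars g (pt sl g))) := by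
  unfold pinLin
  rw [sum_filter_odd M (fun g => c g = true) (fun g => I.vars g (pt sl g)) (fun v => bit (x v)), sum_filter]
  refine sum_congr rfl fun g _ => ?_
  by_cases h : c g = true
  · rw [if_pos h, h]; simp [bit]
  · rw [if_neg h]
    rw [Bool.not_eq_true] at h
    rw [h]; simp [bit]

include hM hsl in
/-- **The evaluation identity**: `A₀(x) = w₁(x) + Σ_{g ∈ M} (x_{sl g} + c g) · x_{pt g}` at every assignment. -/
theorem bit_gval_pinA₀ (x : Fin n → Bool) :
    bit (gval I (pinA₀ I w₁ M sl c).1 (pinA₀ I w₁ M sl c).2.1 x) =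
      bit (gval I w₁.1 w₁.2.1 x) + ∑ g ∈ M, (bit (x (I.vars g (sl g))) + bit (c g)) * bit (x (I.vars g (pt sl g))) := by
  classical
  have e1 : bit (gval I (pinA₀ I w₁ M sl c).1 (pinA₀ I w₁ M sl c).2.1 x) =
      ∑ v ∈ w₁.1, bit (x v) + ∑ v ∈ pinLin I M sl c, bit (x v) + ∑ g ∈ w₁.2.1 \ M, bit (x (I.vars g 2)) * bit (x (I.vars g 3)) := by
    unfold pinA₀; rw [bit_gval, sum_symmDiff_zmod2]
  have e2 : bit (gval I w₁.1 w₁.2.1 x) = ∑ v ∈ w₁.1, bit (x v) + ∑ g ∈ w₁.2.1, bit (x (I.vars g 2)) * bit (x (I.vars g 3)) := bit_gval I _ _ x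
  have e3 : ∑ g ∈ w₁.2.1 \ M, bit (x (I.vars g 2)) * bit (x (I.vars g 3)) + ∑ g ∈ M, bit (x (I.vars g 2)) * bit (x (I.vars g 3)) =
      ∑ g ∈ w₁.2.1, bit (x (I.vars g 2)) * bit (x (I.vars g 3)) := sum_sdiff hM
  have e4 := sum_pinLin I (M := M) (sl := sl) c x
  have e5 : ∑ g ∈ M, (bit (x (I.vars g (sl g))) + bit (c g)) * bit (x (I.vars g (pt sl g))) =
      ∑ g ∈ M, bit (x (I.vars g 2)) * bit (x (I.vars g 3)) + ∑ g ∈ M, bit (c g) * bit (x (I.vars g (pt sl g))) := by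
    rw [← sum_add_distrib]
    exact sum_congr rfl fun g hg => by rw [bit_mono_eq I hsl hg x]; ring
  have hSM : ∑ g ∈ M, bit (x (I.vars g 2)) * bit (x (I.vars g 3)) + ∑ g ∈ M, bit (x (I.vars g 2)) * bit (x (I.vars g 3)) = 0 := by
    generalize ∑ g ∈ M, bit (x (I.vars g 2)) * bit (x (I.vars g 3)) = a; revert a; decide
  linear_combination e1 - e2 - e5 + e3 + e4 - hSM

include hM hsl in
/-- **On `Z`, `A₀ ≡ w₁`**: if every pinned slot takes its pinned value at `x`, the two constraints agree there. -/
theorem gval_pinA₀_of_pinned {x : Fin n → Bool} (hx : ∀ g ∈ M, x (I.vars g (sl g)) = c g) :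
    gval I (pinA₀ I w₁ M sl c).1 (pinA₀ I w₁ M sl c).2.1 x = gval I w₁.1 w₁.2.1 x := by
  apply bit_injective
  rw [bit_gval_pinA₀ I w₁ hM hsl c x, sum_eq_zero fun g hg => ?_, add_zero]
  rw [hx g hg]
  generalize bit (c g) = a; generalize bit (x (I.vars g (pt sl g))) = b; revert a b; decide

end Pin

/-! ## The linearisation -/

/-- **LINEARISATION OF PINNED PARTNERS** (planner p3 g23's prover item; the one-monomial case is `PstarCross2.unionTerminal_of_pinned`): a terminal pair with a set
`M` of monomials of `w₁` whose chosen slots are pinned on `Z` yields LOCAL-union-terminal data for `(pinA₀ w₁ M sl c, w₂)`. -/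
theorem localUnionTerminal_of_pinnedPartners (I : LocalMap 4 n m) (_hI : I.IsPure xorAndPred) (hT : Typed I) {r : ℕ} {y : Fin m → Bool}
    {J₀ : Finset (Fin m)} {w₁ w₂ : Finset (Fin n) × Finset (Fin m) × Bool} (ht : Terminal I r y J₀ w₁ w₂)
    {M : Finset (Fin m)} (hM : M ⊆ w₁.2.1) {sl : Fin m → Fin 4} (hsl : ∀ g ∈ M, sl g = 2 ∨ sl g = 3) {c : Fin m → Bool}
    (hpin : ∀ g ∈ M, PinnedTo I y J₀ w₂ (I.vars g (sl g)) (c g)) :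
    LocalUnionTerminal I r y J₀ (pinA₀ I w₁ M sl c) w₂ := by
  classical
  obtain ⟨hne, hX, hJr, hd₁, hd₂, hrad, hT3, hM0⟩ := ht
  have hGA : (pinA₀ I w₁ M sl c).2.1 = w₁.2.1 \ M := rfl
  have hsl2 : ∀ g ∈ M, 2 ≤ (sl g).val := fun g hg => by
    rcases hsl g hg with h | h
    · rw [h]; decide
    · rw [h]; decide
  -- on `Z` every pinned slot takes its value
  have hZ : ∀ x : Fin n → Bool, (∀ j ∈ J₀, I.eval x j = y j) → gval I w₂.1 w₂.2.1 x = w₂.2.2 → ∀ g ∈ M, x (I.vars g (sl g)) = c g :=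
    fun x hx hxw g hg => eq_of_pinnedTo (hpin g hg) hx hxw
  refine ⟨hne, hX, hJr, ?_, hd₂, ?_, ?_, fun f hf => ?_⟩
  · rw [hGA]; exact hd₁.mono_right sdiff_subset
  · rw [hGA]
    exact (card_le_card (union_subset_union (union_subset_union (Subset.refl J₀) sdiff_subset) (Subset.refl _))).trans hrad
  · -- `(A₀, w₂)` is infeasible on `J₀`: `A₀ ≡ w₁` on `Z`
    rintro ⟨x, hx, hA, hw⟩
    rw [gval_pinA₀_of_pinned I w₁ hM hsl c (hZ x hx hw)] at hA
    exact hT3 ⟨x, hx, hA, hw⟩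
  · -- the cover at `f`: linearise at the Terminal witness
    obtain ⟨x, hxJ, hx1, hx2⟩ := hM0 f hf
    -- the monomials of `M` whose partner is ON at `x`, their pinned slots (with parity), and the target shift
    let corr : Finset (Fin n) := univ.filter fun v => Odd (M.filter fun g => x (I.vars g (pt sl g)) = true ∧ I.vars g (sl g) = v).card
    let κ : ZMod 2 := ∑ g ∈ M.filter (fun g => x (I.vars g (pt sl g)) = true), bit (c g)
    have hcorr : ∀ z : Fin n → Bool, ∑ v ∈ corr, bit (z v) = ∑ g ∈ M.filter (fun g => x (I.vars g (pt sl g)) = true), bit (z (I.vars g (sl g))) :=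
      fun z => sum_filter_odd M (fun g => x (I.vars g (pt sl g)) = true) (fun g => I.vars g (sl g)) (fun v => bit (z v))
    refine ⟨((pinA₀ I w₁ M sl c).1 ∆ corr, (pinA₀ I w₁ M sl c).2.1, tbit (bit w₁.2.2 + κ)), rfl, ?_, ?_, ?_⟩
    · -- the linear parts differ by `corr`: pinned slots, AND-typed
      intro v hv j _
      have hv' : v ∈ corr := by
        have e : (pinA₀ I w₁ M sl c).1 ∆ ((pinA₀ I w₁ M sl c).1 ∆ corr) = corr := symmDiff_symmDiff_cancel_left _ _
        rw [e] at hv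
        exact hv
      have hodd := (mem_filter.1 hv').2
      obtain ⟨g, hg⟩ : (M.filter fun g => x (I.vars g (pt sl g)) = true ∧ I.vars g (sl g) = v).Nonempty := by
        rw [nonempty_iff_ne_empty]
        intro h0
        rw [h0, card_empty] at hodd
        exact absurd hodd (by decide)
      have hgM : g ∈ M := (mem_filter.1 hg).1
      have hgv : I.vars g (sl g) = v := (mem_filter.1 hg).2.2
      rw [← hgv]
      exact ⟨hT j g 0 (sl g) (by decide) (hsl2 g hgM), hT j g 1 (sl g) (by decide) (hsl2 g hgM)⟩
    · -- `(A₁, w₂)` infeasible on `J₀`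
      rintro ⟨z, hzJ, hz1, hz2⟩
      have hpz := hZ z hzJ hz2
      have h1 := congrArg bit hz1
      have hval : bit (gval I ((pinA₀ I w₁ M sl c).1 ∆ corr) (pinA₀ I w₁ M sl c).2.1 z) = bit (gval I w₁.1 w₁.2.1 z) + κ := by
        rw [bit_gval, sum_symmDiff_zmod2, hcorr z, add_right_comm, ← bit_gval, gval_pinA₀_of_pinned I w₁ hM hsl c hpz]
        congr 1
        exact sum_congr rfl fun g hg => by rw [hpz g (mem_filter.1 hg).1]
      have h1' : bit (gval I ((pinA₀ I w₁ M sl c).1 ∆ corr) (pinA₀ I w₁ M sl c).2.1 z) = bit (tbit (bit w₁.2.2 + κ)) := h1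
      rw [hval, bit_tbit] at h1'
      refine hT3 ⟨z, hzJ, bit_injective ?_, hz2⟩
      generalize bit (gval I w₁.1 w₁.2.1 z) = a at h1'
      generalize bit w₁.2.2 = t at h1'
      revert h1'; revert a t; generalize κ = k; revert k; decide
    · -- `(A₁, w₂)` releases `f` at the witness `x`
      refine ⟨x, hxJ, bit_injective ?_, hx2⟩
      show bit (gval I ((pinA₀ I w₁ M sl c).1 ∆ corr) (pinA₀ I w₁ M sl c).2.1 x) = bit (tbit (bit w₁.2.2 + κ))
      rw [bit_tbit, bit_gval, sum_symmDiff_zmod2, hcorr x, add_right_comm, ← bit_gval, bit_gval_pinA₀ I w₁ hM hsl c x,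
        congrArg bit hx1]
      -- `Σ_M (x_s + c) x_p = Σ_{x_p = 1} (x_s + c)`
      have e : ∑ g ∈ M, (bit (x (I.vars g (sl g))) + bit (c g)) * bit (x (I.vars g (pt sl g))) =
          ∑ g ∈ M.filter (fun g => x (I.vars g (pt sl g)) = true), (bit (x (I.vars g (sl g))) + bit (c g)) := by
        rw [sum_filter]
        refine sum_congr rfl fun g _ => ?_
        by_cases h : x (I.vars g (pt sl g)) = true
        · rw [if_pos h, h]; simp [bit]
        · rw [if_neg h]
          rw [Bool.not_eq_true] at h
          rw [h]; simp [bit]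
      rw [e, sum_add_distrib]
      have hSS : ∀ a : ZMod 2, a + a = 0 := by decide
      generalize hs : ∑ g ∈ M.filter (fun g => x (I.vars g (pt sl g)) = true), bit (x (I.vars g (sl g))) = s
      linear_combination hSS s

/-! ## The pinned-partner class of O2 is a theorem -/

/-- **The pinned-partner class follows from `LocalUnionFive`** (planner p3 g23's glue, verbatim). -/
theorem terminalFivePinned_of_localUnionFive (hL : LocalUnionFive) : TerminalFivePinned :=
  fun n m r I hI hT hS hB y J₀ _w₁ w₂ ht F hF hP hmax hch _M hM _sl _c hsl hpin hun =>
    hL n m r I hI hT hS hB y J₀ _ w₂ (localUnionTerminal_of_pinnedPartners I hI hT ht hM hsl hpin) F hF hP hmax hch hun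

/-- **`TerminalFivePinned` holds**: a terminal core with admissible `F`, `w₂` hun-clean, and every monomial of `w₁` outside a set `M` of monomials with a slot pinned
on `Z` hun-clean, has at most five outputs. -/
theorem terminalFivePinned_holds : TerminalFivePinned :=
  terminalFivePinned_of_localUnionFive localUnionFive_holds

end Summit.PneNP.PneNP.Theorems.PstarPinnedPartners
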